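import Mathlib
import Literature.Probability.PointProcesses.LensConsistentLaw
import Literature.MathematicalPhysics.StatisticalMechanics.LennardJonesClusters
import HarnessLib

/-!
# Crux `PatternPricedCertificates` (stmt-AtomisticToContinuum-12974), line `registered`: stub `stub_boxIntegral_shift`

Shift invariance of box integrals of lattice-periodic functions on `ℝ³` (the box `[0,s)³` is a
fundamental domain of `sℤ³`). Helper for `stub_unpricedMeanBound` (shift-averaged cube transport).
-/

noncomputable section

open scoped BigOperators Classical
open MeasureTheory

namespace Summit.AtomisticToContinuum.Crystallization.Theorems.PatternPricedCertificates

/-- **Stub A1 (shift invariance of box averages of lattice-periodic functions).** For `s > 0`, a bounded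
measurable `F : (Fin 3 → ℝ) → ℝ` which is `s`-periodic in each coordinate has
`∫_{[0,s)³} F (u + t) du = ∫_{[0,s)³} F u du` for every `t` (the box is a fundamental domain of `sℤ³`,
and so is its translate; `IsAddFundamentalDomain.setIntegral_eq`). [folklore] -/
theorem stub_boxIntegral_shift :
    ∀ (s : ℝ), 0 < s → ∀ (F : (Fin 3 → ℝ) → ℝ), Measurable F → (∃ M : ℝ, ∀ u, |F u| ≤ M) →
      (∀ (u : Fin 3 → ℝ) (i : Fin 3), F (u + Pi.single i s) = F u) →
      ∀ t : Fin 3 → ℝ,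
        ∫ u in Set.pi Set.univ (fun _ : Fin 3 => Set.Ico (0 : ℝ) s), F (u + t) =
          ∫ u in Set.pi Set.univ (fun _ : Fin 3 => Set.Ico (0 : ℝ) s), F u := by
  intro s hs F _ _ hper t
  -- (a) `F` is invariant under the subgroup generated by the `Pi.single i s`
  have hlat :
      ∀ v ∈ AddSubgroup.closure (Set.range fun i : Fin 3 => (Pi.single i s : Fin 3 → ℝ)),
        ∀ u, F (u + v) = F u := by
    intro v hv
    refine AddSubgroup.closure_induction (fun x hx => ?_) (fun u => by rw [add_zero])
      (fun x y _ _ hx hy u => by rw [← add_assoc, hy, hx]) (fun x _ hx u => ?_) hv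
    · obtain ⟨i, rfl⟩ := hx
      exact fun u => hper u i
    · rw [← hx (u + -x), neg_add_cancel_right]
  -- (b) the scaled basis `b i = Pi.single i s`; its `ZSpan` fundamental domain is the box
  have hw : ∀ _ : Fin 3, IsUnit s := fun _ => hs.ne'.isUnit
  set b : Module.Basis (Fin 3) ℝ (Fin 3 → ℝ) := (Pi.basisFun ℝ (Fin 3)).isUnitSMul hw
    with hb_def
  have hb : ∀ i, b i = Pi.single i s := fun i => by
    rw [hb_def, Module.Basis.isUnitSMul_apply, Pi.basisFun_apply, ← Pi.single_smul, smul_eq_mul,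
      mul_one]
  have hrepr : ∀ (x : Fin 3 → ℝ) (i : Fin 3), b.repr x i = x i / s := fun x i => by
    rw [hb_def, Module.Basis.repr_isUnitSMul, Pi.basisFun_repr, Units.smul_def,
      Units.val_inv_eq_inv_val, IsUnit.unit_spec, smul_eq_mul, div_eq_inv_mul]
  have hbox :
      Set.pi Set.univ (fun _ : Fin 3 => Set.Ico (0 : ℝ) s) = ZSpan.fundamentalDomain b := by
    ext x
    simp only [Set.mem_univ_pi, Set.mem_Ico, ZSpan.mem_fundamentalDomain, hrepr, le_div_iff₀ hs,
      div_lt_iff₀ hs, zero_mul, one_mul]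
  -- (c) the lattice `sℤ³` and the two fundamental domains (the box and its translate by `t`)
  haveI : Countable (Submodule.span ℤ (Set.range b)).toAddSubgroup :=
    inferInstanceAs (Countable (Submodule.span ℤ (Set.range b)))
  haveI : MeasurableConstVAdd (Submodule.span ℤ (Set.range b)).toAddSubgroup (Fin 3 → ℝ) :=
    ⟨fun g => measurable_const_add (g : Fin 3 → ℝ)⟩
  have hFD : IsAddFundamentalDomain (Submodule.span ℤ (Set.range b)).toAddSubgroup
      (ZSpan.fundamentalDomain b) volume :=
    ZSpan.isAddFundamentalDomain' b volume
  have hFD' : IsAddFundamentalDomain (Submodule.span ℤ (Set.range b)).toAddSubgroup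
      ((fun u => u + t) '' ZSpan.fundamentalDomain b) volume := by
    have h := hFD.image_of_equiv (ν := volume) (Equiv.addRight t)
      (by
        rw [Equiv.addRight_symm]
        exact (measurePreserving_add_right volume (-t)).quasiMeasurePreserving)
      (Equiv.refl _) (fun g x => add_assoc _ _ _)
    rwa [Equiv.coe_addRight] at h
  have hinv : ∀ (g : (Submodule.span ℤ (Set.range b)).toAddSubgroup) (x : Fin 3 → ℝ),
      F (g +ᵥ x) = F x := by
    have key : ∀ v : Fin 3 → ℝ, v ∈ (Submodule.span ℤ (Set.range b)).toAddSubgroup →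
        ∀ u, F (u + v) = F u := by
      intro v hv
      rw [Submodule.span_int_eq_addSubgroupClosure,
        show Set.range (⇑b) = Set.range (fun i : Fin 3 => (Pi.single i s : Fin 3 → ℝ)) from
          congr_arg Set.range (funext hb)] at hv
      exact hlat v hv
    intro g x
    rw [AddSubgroup.vadd_def, vadd_eq_add, add_comm]
    exact key _ g.2 x
  -- (d) transport the integral
  rw [hbox, ← (measurePreserving_add_right volume t).setIntegral_image_emb
    (measurableEmbedding_addRight t) F (ZSpan.fundamentalDomain b)]
  exact hFD'.setIntegral_eq hFD hinv

end Summit.AtomisticToContinuum.Crystallization.Theorems.PatternPricedCertificates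

end
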